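import Summits.ValiantsHypothesis.ValiantsHypothesis.Theorems.VPBoundarySquareUniformCover
import Literature.Computability.Complexity.PPolyReductions
import Literature.Computability.Complexity.CountingHierarchyProofs
import Literature.Computability.Complexity.StringEquality
import Literature.Computability.Complexity.CountingHierarchyInter
import Literature.Computability.Complexity.BranchingFn
import HarnessLib

/-!
# VPBoundarySquare — the uniform `CH` cover, CONVERSE direction: `U_CH` is EQUIVALENT to the
# eventually-uniform `CH`-chartability of the border (NODE v11, T5c)

Companion to `Theorems/VPBoundarySquareUniformCover.lean` (T5: `CHClosureDefinable → ∀ d,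
UniformCHCover d`). Here the other direction and the equivalence:

* `hasCoeffFnIn_polyAdvice_CH_of_levelwise` — the TABLE TRICK: if one `L' ∈ CH` answers the
  coefficient queries of an integer family at every level through level-dependent advice `advₙ`
  (`|advₙ ℓ| ≤ ℓ^c + c`), the coefficient function is in `CH/poly` (merge the advice into the table
  `A(ℓ) = ⟨adv₀(ℓ), …, adv_ℓ(ℓ)⟩`, witness `G ⁻¹' L'`, `G : ⟨x, T⟩ ↦ ⟨x, T[|fstF x|]⟩`; `exists_lookup_mem_FP`,
  `preimage_mem_CH`).
* **T5c `chClosureDefinable_of_uniformCHCover : (∀ d, UniformCHCover d) → CHClosureDefinable`** —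
  below the threshold `N` use the TRIVIAL integer charts `Σ_j y_j · x^{e_j}` (`exists_trivialChart`),
  whose true coefficient bits form a FINITE language `F ∈ P` (`trueBits_mem_P`); the witness
  `({z : level z > N} ⊓ L') ⊔ fstF⁻¹ F ∈ CH` answers every level; then the table trick.
* **`chClosureDefinable_iff_uniformCHCover : CHClosureDefinable ↔ ∀ d, UniformCHCover d`** — the
  route's residual `U_CH` IS EXACTLY the single-datum, finite-level, eventually-uniform
  `CH`-chartability of border points, budget by budget.

References: `Burgisser2026HNC` Def. 4.1–4.2; `AroraBarak2009` Def. 6.16, Thm. 2.8; `Toran1991` §3.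
-/

noncomputable section

set_option linter.dupNamespace false

open MvPolynomial Polynomial

open Literature.Computability.AlgebraicComplexity Literature.Computability.Complexity
  Literature.Computability.Complexity.Brick _root_.Computability

open Summit.ValiantsHypothesis.ValiantsHypothesis.Theses.VPBoundarySquare
open Summit.ValiantsHypothesis.ValiantsHypothesis.Theorems.VPBoundarySquareUniformCover

namespace Summit.ValiantsHypothesis.ValiantsHypothesis.Theorems.VPBoundarySquareUniformCoverConverse

/-- **All-levels uniform `CH` cover of the border of budget `d`**: one language `L' ∈ CH` and one
constant `c` whose charts cover every border point of budget `d` at every level (the threshold-free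
form of `UniformCHCover`). [cite: Burgisser2026HNC, Def. 4.1-4.2 (p. 11)] -/
def AllLevelsUniformCHCover (d : ℕ) : Prop :=
  ∃ L' ∈ CH, ∃ c : ℕ, ∀ (n u : ℕ) (g : MvPolynomial (Fin u) ℂ), IsBorderPoint d n g → Covered L' c n g

/-- The all-levels cover implies the eventual one. [folklore] -/
theorem uniformCHCover_of_allLevels {d : ℕ} (h : AllLevelsUniformCHCover d) : UniformCHCover d := by
  obtain ⟨L', hL', c, hc⟩ := h
  exact ⟨L', hL', c, 0, fun n _ u g hg => hc n u g hg⟩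

/-- A coefficient query at level `n` carries `1ⁿ` as its first component. [cite: Burgisser2026HNC, Def. 4.2 (p. 11)] -/
theorem fstF_expCoeffQuery (n : ℕ) {u : ℕ} (e : Fin u →₀ ℕ) (a : ℕ) :
    fstF (expCoeffQuery n e a) = List.replicate n true := by
  rw [expCoeffQuery, fstF_boolPair]

/-- A coefficient query at level `n` has length at least `n` (indeed `≥ 2n + 2`). [cite: Burgisser2026HNC, Def. 4.2 (p. 11)] -/
theorem le_length_expCoeffQuery (n : ℕ) {u : ℕ} (e : Fin u →₀ ℕ) (a : ℕ) :
    n ≤ (expCoeffQuery n e a).length := by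
  rw [expCoeffQuery, length_boolPair, List.length_replicate]
  omega

/-- **Merging per-level advice (the table trick).** If ONE language `L' ∈ CH` answers the
coefficient queries of an integer family `Q` at every level `n` through some level-dependent
advice `advₙ` of length `≤ ℓ^c + c`, then the coefficient function of `Q` is in `CH/poly`: the
single advice `A(ℓ) = ⟨adv₀ ℓ, …, adv_ℓ ℓ⟩` and the witness `G⁻¹ L'`, `G : ⟨x, T⟩ ↦ ⟨x, T[|fstF x|]⟩`
(`exists_lookup_mem_FP`, `preimage_mem_CH`). [cite: AroraBarak2009, Def. 6.16] -/
theorem hasCoeffFnIn_polyAdvice_CH_of_levelwise {v : ℕ → ℕ} (Q : ∀ n, MvPolynomial (Fin (v n)) ℤ)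
    {L' : Language Bool} (hL' : L' ∈ CH) {c : ℕ} (adv : ℕ → ℕ → List Bool)
    (hadv : ∀ n ℓ, (adv n ℓ).length ≤ ℓ ^ c + c)
    (hbits : ∀ (n : ℕ) (e : Fin (v n) →₀ ℕ) (a : ℕ),
      boolPair (expCoeffQuery n e a) (adv n (expCoeffQuery n e a).length) ∈ L' ↔
        coeffFnBit (Q n) e a = true) :
    HasCoeffFnIn (polyAdvice CH) Q := by
  classical
  obtain ⟨look, hlook, hspec⟩ := exists_lookup_mem_FP
  let tab : ℕ → List (List Bool) := fun ℓ => (List.range (ℓ + 1)).map fun n => adv n ℓ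
  let A : ℕ → List Bool := fun ℓ => (tab ℓ).foldr boolPair []
  let G : List Bool → List Bool := fanoutFn fstF (look ∘ fanoutFn (fstF ∘ fstF) sndF)
  have hG : G ∈ FP :=
    fanoutFn_mem_FP fstF_mem_FP
      (comp_mem_FP hlook (fanoutFn_mem_FP (comp_mem_FP fstF_mem_FP fstF_mem_FP) sndF_mem_FP))
  have htab_len : ∀ ℓ, (tab ℓ).length = ℓ + 1 := fun ℓ => by simp [tab]
  have htab_get : ∀ ℓ n (h : n < (tab ℓ).length), (tab ℓ)[n] = adv n ℓ := fun ℓ n h => by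
    simp [tab]
  have hGx : ∀ (n : ℕ) {u : ℕ} (e : Fin u →₀ ℕ) (a : ℕ),
      G (boolPair (expCoeffQuery n e a) (A (expCoeffQuery n e a).length)) =
        boolPair (expCoeffQuery n e a) (adv n (expCoeffQuery n e a).length) := by
    intro n u e a
    have hlt : (List.replicate n true).length < (tab (expCoeffQuery n e a).length).length := by
      rw [List.length_replicate, htab_len]
      exact Nat.lt_succ_of_le (le_length_expCoeffQuery n e a)
    simp only [G, A, fanoutFn_apply, Function.comp_apply, fstF_boolPair, sndF_boolPair,
      fstF_expCoeffQuery]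
    rw [hspec _ _ hlt, htab_get]
    simp
  refine ⟨{x | boolPair x (A x.length) ∈ (G ⁻¹' L' : Language Bool)},
    ⟨G ⁻¹' L', preimage_mem_CH hL' hG, A, ((Polynomial.X + 1) * (2 * Polynomial.X ^ c + Polynomial.C (2 * c + 2)) : Polynomial ℕ),
      fun ℓ => ?_, fun x => Iff.rfl⟩, fun n e a => ?_⟩
  · -- advice length
    have hB : ∀ t ∈ tab ℓ, t.length ≤ ℓ ^ c + c := by
      intro t ht
      simp only [tab, List.mem_map, List.mem_range] at ht
      obtain ⟨m, _, rfl⟩ := ht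
      exact hadv m ℓ
    refine (length_foldr_boolPair_le _ hB).trans (le_of_eq ?_)
    simp [htab_len]
    ring
  · -- the bits
    change G (boolPair (expCoeffQuery n e a) (A (expCoeffQuery n e a).length)) ∈ L' ↔ _
    rw [hGx]
    exact hbits n e a

/-! ### Trivial charts: one new variable per monomial -/

/-- **The trivial integer chart of a complex polynomial.** Every `g ∈ ℂ[x_1..x_u]` with `w`
monomials is `Q(x, κ)` for `Q = Σ_{j<w} y_j · x^{e_j} ∈ ℤ[x, y_1..y_w]` (`e_j` the monomials of
`g`, `κ_j` its coefficients): `deg Q ≤ deg g + 1`, coefficients of absolute value `≤ w` (in fact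
`0/1`). Used below the threshold of an eventual cover. [folklore] -/
theorem exists_trivialChart {u : ℕ} (g : MvPolynomial (Fin u) ℂ) :
    ∃ (w : ℕ) (Q : MvPolynomial (Fin (u + w)) ℤ) (κ : Fin w → ℂ),
      w = g.support.card ∧ Q.totalDegree ≤ g.totalDegree + 1 ∧
      (∀ e, (coeff e Q).natAbs ≤ w) ∧
      g = aeval (Fin.append X fun j => C (κ j)) (MvPolynomial.map (Int.castRingHom ℂ) Q) := by
  classical
  set w := g.support.card with hw
  let s : Fin w → (Fin u →₀ ℕ) := fun j => (g.support.equivFin.symm j : {e // e ∈ g.support})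
  have hs_mem : ∀ j, s j ∈ g.support := fun j => (g.support.equivFin.symm j).2
  let emb : (Fin u →₀ ℕ) → (Fin (u + w) →₀ ℕ) := Finsupp.mapDomain (Fin.castAdd w)
  let mono : Fin w → (Fin (u + w) →₀ ℕ) := fun j => emb (s j) + Finsupp.single (Fin.natAdd u j) 1
  refine ⟨w, ∑ j, monomial (mono j) 1, fun j => coeff (s j) g, rfl, ?_, ?_, ?_⟩
  · -- degree
    refine (totalDegree_finsetSum _ _).trans (Finset.sup_le fun j _ => ?_)
    rw [totalDegree_monomial _ one_ne_zero]
    have h1 : ((mono j).sum fun _ k => k) = ((emb (s j)).sum fun _ k => k) + 1 := by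
      simp only [mono]
      rw [Finsupp.sum_add_index' (fun _ => rfl) (fun _ _ _ => rfl), Finsupp.sum_single_index rfl]
    have h2 : ((emb (s j)).sum fun _ k => k) = (s j).sum fun _ k => k :=
      Finsupp.sum_mapDomain_index_inj (Fin.castAdd_injective _ _)
    rw [h1, h2]
    exact Nat.add_le_add_right (le_totalDegree (hs_mem j)) 1
  · -- coefficients
    intro e
    rw [MvPolynomial.coeff_sum]
    calc (∑ j, coeff e (monomial (mono j) (1 : ℤ))).natAbs
        ≤ ∑ j, (coeff e (monomial (mono j) (1 : ℤ))).natAbs := Int.natAbs_sum_le _ _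
      _ ≤ ∑ _j : Fin w, 1 := Finset.sum_le_sum fun j _ => by
          rw [MvPolynomial.coeff_monomial]; split_ifs <;> simp
      _ = w := by simp
  · -- the identity `g = Q(x, κ)`
    show g = aeval (Fin.append X fun j => C (coeff (s j) g))
      (MvPolynomial.map (Int.castRingHom ℂ) (∑ j, monomial (mono j) (1 : ℤ)))
    set φ : Fin (u + w) → MvPolynomial (Fin u) ℂ := Fin.append X fun j => C (coeff (s j) g) with hφ
    have hterm : ∀ j, aeval φ (MvPolynomial.map (Int.castRingHom ℂ) (monomial (mono j) (1 : ℤ))) =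
        monomial (s j) (coeff (s j) g) := by
      intro j
      rw [MvPolynomial.map_monomial, map_one, MvPolynomial.aeval_monomial, map_one, one_mul]
      simp only [mono]
      rw [Finsupp.prod_add_index' (fun _ => pow_zero _) (fun _ _ _ => pow_add _ _ _),
        Finsupp.prod_single_index (h := fun i k => φ i ^ k) (pow_zero _), pow_one,
        Finsupp.prod_mapDomain_index_inj (Fin.castAdd_injective _ _)]
      have hx : ((s j).prod fun i k => φ (Fin.castAdd w i) ^ k) = monomial (s j) (1 : ℂ) := by
        rw [monomial_eq, MvPolynomial.C_1, one_mul]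
        exact Finsupp.prod_congr fun i _ => by rw [hφ, Fin.append_left]
      rw [hx, hφ, Fin.append_right, mul_comm, MvPolynomial.C_mul_monomial, mul_one]
    rw [map_sum, map_sum]
    simp only [hterm]
    calc g = ∑ e ∈ g.support, monomial e (coeff e g) := g.as_sum
      _ = ∑ x : {e // e ∈ g.support}, monomial (x : Fin u →₀ ℕ) (coeff (x : Fin u →₀ ℕ) g) :=
          (Finset.sum_coe_sort g.support fun e => monomial e (coeff e g)).symm
      _ = ∑ j : Fin w, monomial (s j) (coeff (s j) g) :=
          Fintype.sum_equiv g.support.equivFin _ _ fun x => by simp [s]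

/-! ### Boolean side: levels, finite bit sets, the patched witness language -/

/-- Queries at different levels differ (the unary level prefix). [cite: Burgisser2026HNC, Def. 4.2 (p. 11)] -/
theorem level_eq_of_expCoeffQuery_eq {n n' u u' : ℕ} {e : Fin u →₀ ℕ} {e' : Fin u' →₀ ℕ} {a a' : ℕ}
    (h : expCoeffQuery n e a = expCoeffQuery n' e' a') : n = n' := by
  have := congr_arg (fun l => (fstF l).length) h
  simpa [fstF_expCoeffQuery] using this

/-- The coefficient query is injective in `(e, a)` at a fixed level and arity
(`boolPair`, `encMonomial`, `encodeNat` are injective). [cite: Burgisser2026HNC, Def. 4.2 (p. 11)] -/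
theorem expCoeffQuery_injective {n u : ℕ} {e e' : Fin u →₀ ℕ} {a a' : ℕ}
    (h : expCoeffQuery n e a = expCoeffQuery n e' a') : e = e' ∧ a = a' := by
  have h1 := boolPair_injective (a₁ := (_, _)) (a₂ := (_, _)) h
  simp only [Prod.mk.injEq] at h1
  have h2 := boolPair_injective (a₁ := (_, _)) (a₂ := (_, _)) h1.2
  simp only [Prod.mk.injEq] at h2
  refine ⟨encMonomial_injective h2.1, ?_⟩
  have h3 : encodeNat a = encodeNat a' := h2.2
  have := congr_arg decodeNat h3
  simpa using this

/-- A true coefficient bit forces a nonzero coefficient and a small bit index. [cite: Burgisser2026HNC, §4 (p. 11)] -/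
theorem coeffFnBit_true_bounds {u : ℕ} {Q : MvPolynomial (Fin u) ℤ} {e : Fin u →₀ ℕ} {a : ℕ}
    (h : coeffFnBit Q e a = true) : e ∈ Q.support ∧ a < (coeff e Q).natAbs + 2 := by
  cases a with
  | zero =>
    have h' : coeff e Q < 0 := by simpa [coeffFnBit] using h
    exact ⟨mem_support_iff.2 h'.ne, by omega⟩
  | succ b =>
    have h' : (coeff e Q).natAbs.testBit b = true := by simpa [coeffFnBit] using h
    have hne : (coeff e Q).natAbs ≠ 0 := by
      intro h0; rw [h0, Nat.zero_testBit] at h'; exact Bool.false_ne_true h'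
    have hle : 2 ^ b ≤ (coeff e Q).natAbs := by
      by_contra hlt
      rw [Nat.testBit_eq_false_of_lt (lt_of_not_ge hlt)] at h'
      exact Bool.false_ne_true h'
    refine ⟨mem_support_iff.2 (fun h0 => hne (by rw [h0]; rfl)), ?_⟩
    have := b.lt_two_pow_self
    omega

/-- **The true coefficient bits of finitely many integer polynomials form a FINITE set of
queries.** [folklore] -/
theorem finite_trueBits {v : ℕ → ℕ} (Q : ∀ n, MvPolynomial (Fin (v n)) ℤ) (N : ℕ) :
    ({x | ∃ n, n ≤ N ∧ ∃ (e : Fin (v n) →₀ ℕ) (a : ℕ),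
        x = expCoeffQuery n e a ∧ coeffFnBit (Q n) e a = true} : Set (List Bool)).Finite := by
  refine Set.Finite.subset ((Set.finite_Iic N).biUnion fun n _ =>
    (Q n).support.finite_toSet.biUnion fun e _ =>
      (Set.finite_Iio ((coeff e (Q n)).natAbs + 2)).image fun a => expCoeffQuery n e a) ?_
  rintro x ⟨n, hn, e, a, rfl, hbit⟩
  obtain ⟨he, ha⟩ := coeffFnBit_true_bounds hbit
  simp only [Set.mem_iUnion, Set.mem_image, Set.mem_Iio, Set.mem_Iic, Finset.mem_coe]
  exact ⟨n, hn, e, he, a, ha, rfl⟩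

/-- **The true-bit queries below a threshold form a language in `P`** (a finite language:
finite union of singletons `{w | w = c}`, each an `FP` equality test, starting from `∅ = ⊤ᶜ`).
[cite: AroraBarak2009, Thm. 2.8] -/
theorem trueBits_mem_P {v : ℕ → ℕ} (Q : ∀ n, MvPolynomial (Fin (v n)) ℤ) (N : ℕ) :
    ({x | ∃ n, n ≤ N ∧ ∃ (e : Fin (v n) →₀ ℕ) (a : ℕ),
        x = expCoeffQuery n e a ∧ coeffFnBit (Q n) e a = true} : Language Bool) ∈ Classes.P := by
  classical
  have hfin := finite_trueBits Q N
  suffices h : ∀ s : Finset (List Bool), ((↑s : Set (List Bool)) : Language Bool) ∈ Classes.P by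
    have := h hfin.toFinset
    rwa [Set.Finite.coe_toFinset] at this
  intro s
  induction s using Finset.induction_on with
  | empty =>
    have h : ((⊤ : Language Bool)ᶜ) ∈ Classes.P := compl_mem_P_iff.2 top_mem_P
    rw [compl_top] at h
    rw [Finset.coe_empty]
    exact h
  | insert c s _ ih =>
    rw [Finset.coe_insert, Set.insert_eq]
    have h : ({w | (fun w : List Bool => w) w = (fun _ : List Bool => c) w} : Language Bool) ∈
        Classes.P :=
      setOf_apply_eq_apply_mem_P (PolyTimeComputable.id _) (const_mem_FP _)
    have he : ({w | (fun w : List Bool => w) w = (fun _ : List Bool => c) w} : Language Bool) = {c} :=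
      Set.ext fun w => by simp
    rw [he] at h
    exact union_mem_P h ih

/-- The language of strings `z = ⟨⟨y, _⟩, _⟩` whose inner first component has length `> N`
(for `z = ⟨query, advice⟩`: the query's LEVEL exceeds `N`) is in `P` — a complement of a
preimage of the length test `LenLe`. [cite: AroraBarakCC2009, Def. 2.1] -/
def LevelGT (N : ℕ) : Language Bool :=
  ((fanoutFn (fstF ∘ fstF) (fstF ∘ fstF)) ⁻¹' LenLe (Polynomial.C N) : Language Bool)ᶜ

/-- Membership in `LevelGT`. [folklore] -/
theorem mem_LevelGT_iff (N : ℕ) (z : List Bool) : z ∈ LevelGT N ↔ N < (fstF (fstF z)).length := by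
  change z ∉ ((fanoutFn (fstF ∘ fstF) (fstF ∘ fstF)) ⁻¹' LenLe (Polynomial.C N) : Set (List Bool)) ↔ _
  rw [Set.mem_preimage, fanoutFn_apply, Function.comp_apply]
  change ¬ (boolPair (fstF (fstF z)) (fstF (fstF z)) ∈ LenLe (Polynomial.C N)) ↔ _
  rw [boolPair_mem_LenLe, Polynomial.eval_C, not_le]

/-- `LevelGT N ∈ P`. [cite: AroraBarakCC2009, Def. 2.1] -/
theorem LevelGT_mem_P (N : ℕ) : LevelGT N ∈ Classes.P :=
  compl_mem_P_iff.2 (preimage_mem_P (LenLe_mem_P _)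
    (fanoutFn_mem_FP (comp_mem_FP fstF_mem_FP fstF_mem_FP) (comp_mem_FP fstF_mem_FP fstF_mem_FP)))

/-! ### T5c: the eventual cover suffices; the equivalence -/

/-- **T5c (NODE v11).** `(∀ d, UniformCHCover d) → U_CH`: the EVENTUAL single-datum uniform
`CH` cover of the border (the conclusion of T5) already gives back `CHClosureDefinable`. Below
the threshold use trivial charts (finitely many true bits, a `P` language), above it the datum's
charts; patch the witness language by the level test and merge the advice by the table trick.
[cite: Burgisser2026HNC, Def. 4.1-4.2 (p. 11)] -/
theorem chClosureDefinable_of_uniformCHCover (h : ∀ d, UniformCHCover d) : CHClosureDefinable := by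
  classical
  intro v f hPF hBar
  -- a common budget `d` for the three p-bounds
  obtain ⟨d, hd⟩ := IsPBounded.add_holds (IsPBounded.add_holds hPF.1 hPF.2) hBar
  have hbp : ∀ n, IsBorderPoint d n (f n) := by
    intro n
    have h := hd n
    simp only [Fintype.card_fin] at h
    exact ⟨by omega, by omega, by omega⟩
  obtain ⟨L', hL', c, N, hcov⟩ := h d
  -- charts: trivial ones at levels `≤ N`, the datum's at levels `> N`
  have hex : ∀ n, ∃ (w : ℕ) (Q : MvPolynomial (Fin (v n + w)) ℤ) (κ : Fin w → ℂ),
      f n = aeval (Fin.append X fun j => C (κ j)) (MvPolynomial.map (Int.castRingHom ℂ) Q) ∧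
      (n ≤ N → w = (f n).support.card ∧ Q.totalDegree ≤ (f n).totalDegree + 1 ∧
        ∀ e, (coeff e Q).natAbs ≤ w) ∧
      (N < n → IsChart L' c n Q) := by
    intro n
    by_cases hn : n ≤ N
    · obtain ⟨w, Q, κ, hw, hdeg, hco, hf⟩ := exists_trivialChart (f n)
      exact ⟨w, Q, κ, hf, fun _ => ⟨hw, hdeg, hco⟩, fun h => absurd h (not_lt.2 hn)⟩
    · obtain ⟨w, Q, κ, hch, hf⟩ := hcov n (le_of_lt (not_le.1 hn)) (v n) (f n) (hbp n)
      exact ⟨w, Q, κ, hf, fun h => absurd h hn, fun _ => hch⟩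
  choose w Q κ hf hsmall hbig using hex
  -- advice: empty at small levels, the chart's at large levels
  have hadv_ex : ∀ n, ∃ adv : ℕ → List Bool, (∀ ℓ, (adv ℓ).length ≤ ℓ ^ c + c) ∧
      (N < n → ∀ (e : Fin (v n + w n) →₀ ℕ) (a : ℕ),
        boolPair (expCoeffQuery n e a) (adv (expCoeffQuery n e a).length) ∈ L' ↔
          coeffFnBit (Q n) e a = true) := by
    intro n
    by_cases hn : N < n
    · obtain ⟨adv, hadv, hbits⟩ := (hbig n hn).2.2.2
      exact ⟨adv, hadv, fun _ => hbits⟩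
    · exact ⟨fun _ => [], fun ℓ => by simp, fun h => absurd h hn⟩
  choose adv hadv hbits using hadv_ex
  let F : Language Bool := {x | ∃ n, n ≤ N ∧ ∃ (e : Fin (v n + w n) →₀ ℕ) (a : ℕ),
    x = expCoeffQuery n e a ∧ coeffFnBit (Q n) e a = true}
  have hF : F ∈ Classes.P := trueBits_mem_P Q N
  let W : Language Bool := (LevelGT N ⊓ L') ⊔ (fstF ⁻¹' F : Language Bool)
  have hW : W ∈ CH :=
    union_mem_CH (inter_mem_CH (P_subset_CH (LevelGT_mem_P N)) hL')
      (preimage_mem_CH (P_subset_CH hF) fstF_mem_FP)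
  have hmemF : ∀ (n : ℕ) (e : Fin (v n + w n) →₀ ℕ) (a : ℕ),
      expCoeffQuery n e a ∈ F ↔ n ≤ N ∧ coeffFnBit (Q n) e a = true := by
    intro n e a
    constructor
    · rintro ⟨n', hn', e', a', hx, hbit⟩
      obtain rfl : n = n' := level_eq_of_expCoeffQuery_eq hx
      obtain ⟨rfl, rfl⟩ := expCoeffQuery_injective hx
      exact ⟨hn', hbit⟩
    · rintro ⟨hn, hbit⟩
      exact ⟨n, hn, e, a, rfl, hbit⟩
  have hbitsW : ∀ (n : ℕ) (e : Fin (v n + w n) →₀ ℕ) (a : ℕ),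
      boolPair (expCoeffQuery n e a) (adv n (expCoeffQuery n e a).length) ∈ W ↔
        coeffFnBit (Q n) e a = true := by
    intro n e a
    change (boolPair (expCoeffQuery n e a) (adv n (expCoeffQuery n e a).length) ∈ LevelGT N ∧
        boolPair (expCoeffQuery n e a) (adv n (expCoeffQuery n e a).length) ∈ L') ∨
      fstF (boolPair (expCoeffQuery n e a) (adv n (expCoeffQuery n e a).length)) ∈ F ↔ _
    rw [fstF_boolPair, mem_LevelGT_iff, fstF_boolPair, fstF_expCoeffQuery,
      List.length_replicate, hmemF]
    by_cases hn : N < n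
    · rw [hbits n hn]
      constructor
      · rintro (⟨_, h⟩ | ⟨h, _⟩)
        · exact h
        · exact absurd hn (not_lt.2 h)
      · exact fun h => Or.inl ⟨hn, h⟩
    · constructor
      · rintro (⟨h, _⟩ | ⟨_, h⟩)
        · exact absurd h hn
        · exact h
      · exact fun h => Or.inr ⟨not_lt.1 hn, h⟩
  -- the format bound: `n^c + c` plus a constant absorbing the finitely many small levels
  let M : ℕ := (Finset.range (N + 1)).sup fun n => v n + w n + (f n).totalDegree + 2
  have hM : ∀ n, n ≤ N → v n + w n + (f n).totalDegree + 2 ≤ M := fun n hn =>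
    Finset.le_sup (f := fun n => v n + w n + (f n).totalDegree + 2)
      (Finset.mem_range.2 (Nat.lt_succ_of_le hn))
  obtain ⟨c', hc'⟩ := IsPBounded.add_holds (⟨c, fun n => le_rfl⟩ : IsPBounded fun n => n ^ c + c)
    (IsPBounded.const M)
  refine ⟨w, Q, κ, ⟨⟨fun n => n ^ c + c + M, ⟨c', hc'⟩, fun n => ?_⟩,
    hasCoeffFnIn_polyAdvice_CH_of_levelwise Q hW adv hadv hbitsW⟩, hf⟩
  -- exponential format, level by level
  have h2 : ∀ m : ℕ, m < 2 ^ m := fun m => m.lt_two_pow_self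
  by_cases hn : N < n
  · obtain ⟨hvar, hdeg, hco, -⟩ := hbig n hn
    refine ⟨hvar.trans (Nat.le_add_right _ _),
      hdeg.trans (Nat.pow_le_pow_right (by norm_num) (Nat.le_add_right _ _)), fun e => ?_⟩
    exact (hco e).trans_le
      (Nat.pow_le_pow_right (by norm_num) (Nat.pow_le_pow_right (by norm_num) (Nat.le_add_right _ _)))
  · have hn' : n ≤ N := not_lt.1 hn
    obtain ⟨-, hdeg, hco⟩ := hsmall n hn'
    have hMn := hM n hn'
    refine ⟨show v n + w n ≤ n ^ c + c + M by omega, ?_, fun e => ?_⟩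
    · show (Q n).totalDegree ≤ 2 ^ (n ^ c + c + M)
      exact hdeg.trans ((show (f n).totalDegree + 1 ≤ n ^ c + c + M by omega).trans (h2 _).le)
    · show (coeff e (Q n)).natAbs < 2 ^ 2 ^ (n ^ c + c + M)
      calc (coeff e (Q n)).natAbs ≤ w n := hco e
        _ < 2 ^ (n ^ c + c + M) := lt_of_lt_of_le (by omega) (h2 _).le
        _ ≤ 2 ^ 2 ^ (n ^ c + c + M) := Nat.pow_le_pow_right (by norm_num) (h2 _).le

/-- **NODE v11, the equivalence.** The route's residual `U_CH = CHClosureDefinable` is EXACTLY the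
eventually-uniform single-datum `CH`-chartability of the border, budget by budget
(T5 `uniformCHCover_of_chClosureDefinable` and T5c). [cite: Burgisser2026HNC, Def. 4.1-4.2 (p. 11)] -/
theorem chClosureDefinable_iff_uniformCHCover : CHClosureDefinable ↔ ∀ d, UniformCHCover d :=
  ⟨uniformCHCover_of_chClosureDefinable, chClosureDefinable_of_uniformCHCover⟩

/-- **T5b.** In particular the ALL-LEVELS uniform cover gives `U_CH` (through the eventual one).
[cite: Burgisser2026HNC, Def. 4.1-4.2 (p. 11)] -/
theorem chClosureDefinable_of_allLevelsUniformCHCover (h : ∀ d, AllLevelsUniformCHCover d) :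
    CHClosureDefinable :=
  chClosureDefinable_of_uniformCHCover fun d => uniformCHCover_of_allLevels (h d)

end Summit.ValiantsHypothesis.ValiantsHypothesis.Theorems.VPBoundarySquareUniformCoverConverse
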